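import Summits.CriticalPhenomena.PercolationContinuityZ3.Theorems.SahiMasterFamilySectionExpansion

/-!
# Conjunctive pinning at EVERY order: `E_k(μ_p; 1_{C ∩ {e∈ω}}, 1_{U'})` expanded over the sub-families of the `1`-minor, with nonnegative coefficients

Unit `prim-master-conj` (crux anchor stmt-CriticalPhenomena-4575, helper work), gen 16; memo
`run/shared/lean/prim/prim-l12/prim-master-conj/POINTWISE.md` §17.  Gen 15's identity (A) (`Pointwise.sahiE_three_interCoord_eq`) is the case `k = 3`.

THE IDENTITY (`sahiE_ind_pin_eq`).  `p` any point of the closed cube, `e` a coordinate, `t = p_e`, `C` an `e`-free event, `U' = (U'_0,…,U'_{m−1})` ANY events,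
`X¹ = secAt e true X`, `σ = μ_p − μ_{p[e↦1]}` (the signed weight of `…SectionExpansion`):

  `E_{m+1}(μ_p; 1_{C ∩ {e∈ω}}, 1_{U'}) = t · ( E_{m+1}(μ_p; 1_C, 1_{U'¹}) − Σ_{A ⊆ slots} E_{|A|}(σ; 1_{U'_A}) · E_{m−|A|+1}(μ_p; 1_C, 1_{(U'¹)_{Aᶜ}}) )`

— the pinned family is `t` times a combination of the functionals of the `1`-MINOR `(C, U'¹)` and of its sub-families containing `C`, with the
coefficients `W_p(U'_A) = −E_{|A|}(σ; 1_{U'_A})`, which are `≥ 0` for increasing `U'` and transfer their zeros (`…SectionExpansion`).  In generating-function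
terms: `G(U) = G(U'⁰)^{1−t}·G(C,U'¹)^{t}` and `∂_{u_0}` of it.  Proof here: induction on `m` along the Lieb–Sahi recursion at the pinned slot; the inductive
step is closed by the section expansion of `E_m(μ_p; 1_{U'})`.  Consequences (domination `E_k(U) ≥ t·E_k(1-minor)`, `C_k` and the pointwise statement inherited
from the minor's sub-families at every order) are in `…PointwisePinningSettled`.
HONEST FRAMING: an identity; nothing is claimed about `C_k` / `MasterFamilyEqIff k` in general.  Axioms standard. [this work]
-/

noncomputable section

open scoped Classical

namespace Summit.CriticalPhenomena.PercolationContinuityZ3.Theorems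

open Finset Function
open Literature.Combinatorics.Sahi2008
open Literature.Probability.Percolation.DecisionTree (ind ind_of_mem ind_of_not_mem ind_nonneg)
open SahiTotalCumulance (sahiE_cast' sum_eq_sum_orderEmbOfFin)
open WeightSum (sahiE_sub_congr sub_update_of_not_mem sub_update_orderEmbOfFin sahiE_sub_univ sahiE_cons_rec_ite sum_sub_update_mem
  sum_powerset_map)

namespace Pinning

variable {α : Type*} [Fintype α]

/-! ### Plumbing: moving a slot to the front; sub-families along `succAbove`; erasing a slot of a sub-family -/

section Plumbing

variable {m : ℕ}

/-- **Symmetry**: `E_{m+1}(F) = E_{m+1}(F_i, F ∘ i.succAbove)` — any slot may be moved to the front. [cite: Sahi2008, eqs. (4)–(7) (symmetry);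
tree `sahiE_comp_perm`] -/
theorem sahiE_eq_cons_succAbove (μ : α → ℝ) (F : Fin (m + 1) → α → ℝ) (i : Fin (m + 1)) :
    sahiE μ (m + 1) F = sahiE μ (m + 1) (Matrix.vecCons (F i) (fun j => F (i.succAbove j)) : Fin (m + 1) → α → ℝ) := by
  have hF : F = fun j => (Fin.cons (F i) (fun j => F (i.succAbove j)) : Fin (m + 1) → α → ℝ) (i.cycleRange j) := by
    funext j
    rw [Fin.cons_apply_cycleRange]
    exact (congrFun (Fin.insertNth_self_removeNth i F) j).symm
  conv_lhs => rw [hF]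
  rw [sahiE_comp_perm]
  rfl

omit [Fintype α] in
/-- The increasing enumeration of `B.map (succAbove l)` is `succAbove l ∘` (enumeration of `B`). [folklore] -/
theorem orderEmbOfFin_map_succAbove (l : Fin (m + 1)) (B : Finset (Fin m)) (j : Fin B.card) :
    (B.map (Fin.succAboveEmb l)).orderEmbOfFin (card_map _) j = l.succAbove (B.orderEmbOfFin rfl j) := by
  have e : (fun j : Fin B.card => l.succAbove (B.orderEmbOfFin rfl j)) = (B.map (Fin.succAboveEmb l)).orderEmbOfFin (card_map _) :=
    Finset.orderEmbOfFin_unique _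
      (fun j => Finset.mem_map_of_mem (Fin.succAboveEmb l) (Finset.orderEmbOfFin_mem B rfl j))
      ((Fin.strictMono_succAbove l).comp (B.orderEmbOfFin rfl).strictMono)
  exact (congrFun e j).symm

/-- Sub-families along `B.map (succAbove l)` are the sub-families of `F ∘ succAbove l` along `B`. [folklore] -/
theorem sahiE_sub_map_succAbove (μ : α → ℝ) {β : Type*} (F : Fin (m + 1) → β) (φ : β → α → ℝ) (l : Fin (m + 1)) (B : Finset (Fin m)) :
    sahiE μ (B.map (Fin.succAboveEmb l)).card (fun j => φ (F ((B.map (Fin.succAboveEmb l)).orderEmbOfFin rfl j))) =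
      sahiE μ B.card (fun j => φ (F (l.succAbove (B.orderEmbOfFin rfl j)))) := by
  have hc : B.card = (B.map (Fin.succAboveEmb l)).card := (card_map _).symm
  rw [← sahiE_cast' μ hc]
  congr 1
  funext j
  have h1 : (B.map (Fin.succAboveEmb l)).orderEmbOfFin rfl (Fin.cast hc j) = (B.map (Fin.succAboveEmb l)).orderEmbOfFin (card_map _) j :=
    Finset.orderEmbOfFin_eq_orderEmbOfFin_iff.mpr rfl
  rw [h1, orderEmbOfFin_map_succAbove]

omit [Fintype α] in
/-- Complement of `B.map (succAbove l)` in `Fin (m+1)`. [folklore] -/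
theorem compl_map_succAbove (l : Fin (m + 1)) (B : Finset (Fin m)) :
    (B.map (Fin.succAboveEmb l))ᶜ = insert l (Bᶜ.map (Fin.succAboveEmb l)) := by
  ext x
  rcases Fin.eq_self_or_eq_succAbove l x with rfl | ⟨y, rfl⟩
  · simp [Fin.succAbove_ne]
  · simp [Fin.succAbove_ne, (Fin.succAbove_right_injective (p := l)).eq_iff]

omit [Fintype α] in
/-- Erasing the slot `S.orderEmbOfFin j₀` from the enumeration of `S`: the remaining enumeration is that of `S.erase _`. [folklore] -/
theorem orderEmbOfFin_succAbove_eq_erase {N : ℕ} (S : Finset (Fin N)) {k : ℕ} (hk : S.card = k + 1) (j₀ : Fin (k + 1)) (j : Fin k) :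
    S.orderEmbOfFin hk (j₀.succAbove j) = (S.erase (S.orderEmbOfFin hk j₀)).orderEmbOfFin
      (by rw [Finset.card_erase_of_mem (Finset.orderEmbOfFin_mem S hk j₀), hk]; rfl) j := by
  have e : (fun j : Fin k => S.orderEmbOfFin hk (j₀.succAbove j)) = (S.erase (S.orderEmbOfFin hk j₀)).orderEmbOfFin
      (by rw [Finset.card_erase_of_mem (Finset.orderEmbOfFin_mem S hk j₀), hk]; rfl) := by
    refine Finset.orderEmbOfFin_unique _ (fun j => ?_) ((S.orderEmbOfFin hk).strictMono.comp (Fin.strictMono_succAbove j₀))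
    exact Finset.mem_erase.mpr ⟨(S.orderEmbOfFin hk).injective.ne (Fin.succAbove_ne j₀ j), Finset.orderEmbOfFin_mem S hk _⟩
  exact congrFun e j

/-- **A sub-family functional with one of its slots moved to the front**: for `l ∈ S`,
`E_{|S|}(F_S) = E_{|S∖l|+1}(F_l, F_{S∖l})`. [folklore] -/
theorem sahiE_sub_eq_cons_erase (μ : α → ℝ) {N : ℕ} (F : Fin N → α → ℝ) (S : Finset (Fin N)) {l : Fin N} (hl : l ∈ S) :
    sahiE μ S.card (fun j => F (S.orderEmbOfFin rfl j)) =
      sahiE μ ((S.erase l).card + 1) (Matrix.vecCons (F l) (fun j => F ((S.erase l).orderEmbOfFin rfl j)) : Fin ((S.erase l).card + 1) → α → ℝ) := by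
  have hk : S.card = (S.erase l).card + 1 := (Finset.card_erase_add_one hl).symm
  -- the position of `l`
  obtain ⟨j₀, hj₀⟩ : ∃ j₀ : Fin ((S.erase l).card + 1), S.orderEmbOfFin hk j₀ = l := by
    have : l ∈ Set.range (S.orderEmbOfFin hk) := by rw [Finset.range_orderEmbOfFin]; exact hl
    exact this
  rw [← sahiE_cast' μ hk.symm (fun j => F (S.orderEmbOfFin rfl j))]
  have hcast : (fun j : Fin ((S.erase l).card + 1) => F (S.orderEmbOfFin rfl (Fin.cast hk.symm j))) = fun j => F (S.orderEmbOfFin hk j) := by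
    funext j; exact congrArg F (Finset.orderEmbOfFin_eq_orderEmbOfFin_iff.mpr rfl)
  rw [hcast, sahiE_eq_cons_succAbove μ _ j₀]
  congr 1
  funext j
  refine Fin.cases ?_ (fun j' => ?_) j
  · simp [hj₀]
  · simp only [Matrix.cons_val_succ]
    rw [orderEmbOfFin_succAbove_eq_erase S hk j₀ j']
    have key : ∀ (X : Finset (Fin N)) (hX : X.card = (S.erase l).card) (hXY : X = S.erase l),
        X.orderEmbOfFin hX j' = (S.erase l).orderEmbOfFin rfl j' := by
      intro X hX hXY; subst hXY; exact Finset.orderEmbOfFin_eq_orderEmbOfFin_iff.mpr rfl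
    exact congrArg F (key _ _ (by rw [hj₀]))

omit [Fintype α] in
/-- **Double-sum reindexing**: pairs `(A, l ∉ A)` of `Fin (m+1)` are pairs `(l, B)` with `B ⊆ Fin m`, `A = B.map (succAbove l)`. [folklore] -/
theorem sum_sum_compl_eq_sum_sum_map_succAbove {M : Type*} [AddCommMonoid M] (G : Fin (m + 1) → Finset (Fin (m + 1)) → M) :
    ∑ A : Finset (Fin (m + 1)), ∑ l ∈ Aᶜ, G l A = ∑ l : Fin (m + 1), ∑ B : Finset (Fin m), G l (B.map (Fin.succAboveEmb l)) := by
  rw [Finset.sum_comm' (t' := (univ : Finset (Fin (m + 1)))) (s' := fun l => ((univ : Finset (Fin m)).map (Fin.succAboveEmb l)).powerset)]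
  · refine Finset.sum_congr rfl fun l _ => ?_
    rw [sum_powerset_map, Finset.powerset_univ]
  · intro A l
    simp only [Finset.mem_univ, true_and, and_true, Finset.mem_compl, Finset.mem_powerset]
    constructor
    · intro hl x hx
      rcases Fin.eq_self_or_eq_succAbove l x with rfl | ⟨y, rfl⟩
      · exact absurd hx hl
      · exact Finset.mem_map_of_mem _ (Finset.mem_univ y)
    · intro hA hl
      obtain ⟨y, -, hy⟩ := Finset.mem_map.mp (hA hl)
      exact Fin.succAbove_ne l y hy

/-- Casting the tail index type of a `cons` family. [folklore] -/
theorem sahiE_cons_cast (μ : α → ℝ) {k k' : ℕ} (h : k = k') (f₀ : α → ℝ) (G : Fin k' → α → ℝ) :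
    sahiE μ (k + 1) (Matrix.vecCons f₀ (fun j => G (Fin.cast h j)) : Fin (k + 1) → α → ℝ) =
      sahiE μ (k' + 1) (Matrix.vecCons f₀ G : Fin (k' + 1) → α → ℝ) := by
  subst h; rfl

/-- `cons`-sub-families along equal index sets agree (dependent rewriting helper). [folklore] -/
theorem sahiE_cons_sub_congr (μ : α → ℝ) {N : ℕ} (f₀ : α → ℝ) (F : Fin N → α → ℝ) {X Y : Finset (Fin N)} (hXY : X = Y) :
    sahiE μ (X.card + 1) (Matrix.vecCons f₀ (fun j => F (X.orderEmbOfFin rfl j)) : Fin (X.card + 1) → α → ℝ) =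
      sahiE μ (Y.card + 1) (Matrix.vecCons f₀ (fun j => F (Y.orderEmbOfFin rfl j)) : Fin (Y.card + 1) → α → ℝ) := by
  subst hXY; rfl

/-- `cons`-sub-families along `B.map (succAbove l)`. [folklore] -/
theorem sahiE_cons_sub_map_succAbove (μ : α → ℝ) {β : Type*} (f₀ : α → ℝ) (F : Fin (m + 1) → β) (φ : β → α → ℝ) (l : Fin (m + 1))
    (B : Finset (Fin m)) :
    sahiE μ ((B.map (Fin.succAboveEmb l)).card + 1)
        (Matrix.vecCons f₀ (fun j => φ (F ((B.map (Fin.succAboveEmb l)).orderEmbOfFin rfl j))) :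
          Fin ((B.map (Fin.succAboveEmb l)).card + 1) → α → ℝ) =
      sahiE μ (B.card + 1) (Matrix.vecCons f₀ (fun j => φ (F (l.succAbove (B.orderEmbOfFin rfl j)))) : Fin (B.card + 1) → α → ℝ) := by
  have hc : (B.map (Fin.succAboveEmb l)).card = B.card := card_map _
  rw [← sahiE_cons_cast μ hc f₀ (fun j => φ (F (l.succAbove (B.orderEmbOfFin rfl j))))]
  congr 1
  funext j
  refine Fin.cases rfl (fun j' => ?_) j
  simp only [Matrix.cons_val_succ]
  have h1 : (B.map (Fin.succAboveEmb l)).orderEmbOfFin rfl j' = (B.map (Fin.succAboveEmb l)).orderEmbOfFin (card_map _) (Fin.cast hc j') :=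
    Finset.orderEmbOfFin_eq_orderEmbOfFin_iff.mpr rfl
  rw [h1, orderEmbOfFin_map_succAbove]

omit [Fintype α] in
/-- Values of an updated family off the updated slot, along `succAbove`. [folklore] -/
theorem update_succAbove_eq {β : Type*} (V : Fin (m + 1) → β) (l : Fin (m + 1)) (Y : β) (j : Fin m) :
    update V l Y (l.succAbove j) = V (l.succAbove j) :=
  update_of_ne (Fin.succAbove_ne l j) _ _

end Plumbing

/-! ### The identity -/

section Main

variable {ι : Type} [Fintype ι]

omit [Fintype ι] in
/-- A member intersected with the pinned event is the pin of its `1`-section intersected with `C`. [folklore] -/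
theorem inter_pin_eq (e : ι) (X C : Set (Set ι)) :
    X ∩ (C ∩ {ω : Set ι | e ∈ ω}) = (secAt e true X ∩ C) ∩ {ω : Set ι | e ∈ ω} := by
  ext ω
  simp only [Set.mem_inter_iff, Set.mem_setOf_eq, mem_secAt, forceAt, cond_true]
  constructor
  · rintro ⟨hX, hC, he⟩; exact ⟨⟨by rwa [Set.insert_eq_of_mem he], hC⟩, he⟩
  · rintro ⟨⟨hX, hC⟩, he⟩; exact ⟨by rwa [Set.insert_eq_of_mem he] at hX, hC, he⟩

omit [Fintype ι] in
/-- Sections are `e`-free: `(X¹)^{e←b} = X¹`. [folklore] -/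
theorem secAt_secAt_true (e : ι) (b : Bool) (X : Set (Set ι)) : secAt e b (secAt e true X) = secAt e true X := by
  ext ω
  simp only [mem_secAt, forceAt, cond_true]
  cases b
  · simp only [cond_false, Set.insert_sdiff_singleton]
  · simp only [cond_true, Set.insert_eq_of_mem (Set.mem_insert e ω)]

omit [Fintype ι] in
/-- The `1`-section of `C ∩ {e ∈ ω}` is `C` and its `0`-section is `∅`, for `e`-free `C`. [folklore] -/
theorem secAt_pin (e : ι) {C : Set (Set ι)} (hC : ∀ b : Bool, secAt e b C = C) :
    secAt e true (C ∩ {ω : Set ι | e ∈ ω}) = C ∧ secAt e false (C ∩ {ω : Set ι | e ∈ ω}) = ∅ := by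
  rw [secAt_inter, secAt_inter, hC, hC, SahiCombDisjunct.secAt_true_coord, SahiCombDisjunct.secAt_false_coord]
  exact ⟨Set.inter_univ C, Set.inter_empty C⟩

/-- **Conjunctive pinning, every order (identity).**  For `p` in the closed cube, a coordinate `e` (`t = p_e`), an `e`-free event `C` and ANY events
`U'_0,…,U'_{m−1}`, with `X¹ = secAt e true X` and `σ = μ_p − μ_{p[e↦1]}`:
`E_{m+1}(μ_p; 1_{C∩{e∈ω}}, 1_{U'}) = t·( E_{m+1}(μ_p; 1_C, 1_{U'¹}) − Σ_A E_{|A|}(σ; 1_{U'_A})·E_{|Aᶜ|+1}(μ_p; 1_C, 1_{(U'¹)_{Aᶜ}}) )`.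
The coefficients `−E_{|A|}(σ; 1_{U'_A})` are `≥ 0` for increasing `U'` (`sahiE_signedWeight_nonpos`). [this work] -/
theorem sahiE_ind_pin_eq (p : ι → unitInterval) (e : ι) :
    ∀ (m : ℕ) (C : Set (Set ι)), (∀ b : Bool, secAt e b C = C) → ∀ (U' : Fin m → Set (Set ι)),
      sahiE (bernoulliWeight p) (m + 1)
          (Matrix.vecCons (ind (C ∩ {ω : Set ι | e ∈ ω})) (fun j => ind (U' j)) : Fin (m + 1) → Set ι → ℝ) =
        (p e : ℝ) *
          (sahiE (bernoulliWeight p) (m + 1)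
              (Matrix.vecCons (ind C) (fun j => ind (secAt e true (U' j))) : Fin (m + 1) → Set ι → ℝ) -
            ∑ A : Finset (Fin m),
              sahiE (bernoulliWeight p - bernoulliWeight (update p e 1)) A.card (fun j => ind (U' (A.orderEmbOfFin rfl j))) *
                sahiE (bernoulliWeight p) (Aᶜ.card + 1)
                  (Matrix.vecCons (ind C) (fun j => ind (secAt e true (U' (Aᶜ.orderEmbOfFin rfl j)))) :
                    Fin (Aᶜ.card + 1) → Set ι → ℝ))
  | 0, C, hC, U' => by
    rw [sahiE_one_apply, sahiE_one_apply, Matrix.cons_val_zero, Matrix.cons_val_zero,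
      SahiCombDisjunct.ex_ind_of_secAt p e (secAt_pin e hC).1 (secAt_pin e hC).2, SahiCombDisjunct.ex_ind_empty,
      Finset.sum_eq_zero fun A _ => ?_]
    · ring
    · rw [WeightSum.sahiE_sub_eq_zero_of_card (bernoulliWeight p - bernoulliWeight (update p e 1)) (fun j => ind (U' j))
        (Finset.card_eq_zero.mpr (Finset.eq_empty_of_isEmpty A)), zero_mul]
  | m + 1, C, hC, U' => by
    have IH := sahiE_ind_pin_eq p e m
    -- (0) the pinned member: one-coordinate data
    have Xf : ex (bernoulliWeight p) (ind (C ∩ {ω : Set ι | e ∈ ω})) = (p e : ℝ) * ex (bernoulliWeight p) (ind C) := by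
      rw [SahiCombDisjunct.ex_ind_of_secAt p e (secAt_pin e hC).1 (secAt_pin e hC).2, SahiCombDisjunct.ex_ind_empty]; ring
    have hCl : ∀ (l : Fin (m + 1)) (b : Bool), secAt e b (secAt e true (U' l) ∩ C) = secAt e true (U' l) ∩ C := fun l b => by
      rw [secAt_inter, secAt_secAt_true, hC]
    -- (1) the left-hand side: recursion at the pinned slot, each term a pinned family with pin at slot `l`, moved to the front, then IH
    have hL : ∀ l : Fin (m + 1),
        sahiE (bernoulliWeight p) (m + 1) (update (fun j => ind (U' j)) l ((fun j => ind (U' j)) l * ind (C ∩ {ω : Set ι | e ∈ ω}))) =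
          (p e : ℝ) *
            (sahiE (bernoulliWeight p) (m + 1)
                (Matrix.vecCons (ind (secAt e true (U' l) ∩ C)) (fun j => ind (secAt e true (U' (l.succAbove j)))) :
                  Fin (m + 1) → Set ι → ℝ) -
              ∑ B : Finset (Fin m),
                sahiE (bernoulliWeight p - bernoulliWeight (update p e 1)) B.card
                    (fun j => ind (U' (l.succAbove (B.orderEmbOfFin rfl j)))) *
                  sahiE (bernoulliWeight p) (Bᶜ.card + 1)
                    (Matrix.vecCons (ind (secAt e true (U' l) ∩ C))
                      (fun j => ind (secAt e true (U' (l.succAbove (Bᶜ.orderEmbOfFin rfl j))))) : Fin (Bᶜ.card + 1) → Set ι → ℝ)) := by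
      intro l
      rw [update_ind_mul_ind, sahiE_eq_cons_succAbove _ _ l]
      simp only [update_self, update_succAbove_eq]
      rw [inter_pin_eq e (U' l) C]
      exact IH (secAt e true (U' l) ∩ C) (hCl l) (fun j => U' (l.succAbove j))
    -- (2) the minor's recursion: `E(1_C, 1_{U'¹}) = Σ_l X_l − E(1_{U'¹})·μC`
    have hR1 : sahiE (bernoulliWeight p) (m + 2)
          (Matrix.vecCons (ind C) (fun j => ind (secAt e true (U' j))) : Fin (m + 2) → Set ι → ℝ) =
        (∑ l : Fin (m + 1), sahiE (bernoulliWeight p) (m + 1)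
            (Matrix.vecCons (ind (secAt e true (U' l) ∩ C)) (fun j => ind (secAt e true (U' (l.succAbove j)))) :
              Fin (m + 1) → Set ι → ℝ)) -
          sahiE (bernoulliWeight p) (m + 1) (fun j => ind (secAt e true (U' j))) * ex (bernoulliWeight p) (ind C) := by
      rw [sahiE_cons]
      congr 1
      refine Finset.sum_congr rfl fun l _ => ?_
      rw [update_ind_mul_ind, sahiE_eq_cons_succAbove _ _ l]
      simp only [update_self, update_succAbove_eq]
    -- (3) the section expansion of `E(1_{U'})`
    have hSE := sahiE_ind_section_expansion p e U'
    -- (4) each `cons`-sub-family of the minor: head recursion, inner sum over the slots of `Aᶜ`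
    have hA : ∀ A : Finset (Fin (m + 1)),
        sahiE (bernoulliWeight p) (Aᶜ.card + 1)
            (Matrix.vecCons (ind C) (fun j => ind (secAt e true (U' (Aᶜ.orderEmbOfFin rfl j)))) : Fin (Aᶜ.card + 1) → Set ι → ℝ) =
          (∑ l ∈ Aᶜ, sahiE (bernoulliWeight p) Aᶜ.card
              (fun i => update (fun j => ind (secAt e true (U' j))) l
                ((fun j => ind (secAt e true (U' j))) l * ind C) (Aᶜ.orderEmbOfFin rfl i))) -
            sahiE (bernoulliWeight p) Aᶜ.card (fun j => ind (secAt e true (U' (Aᶜ.orderEmbOfFin rfl j)))) *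
              ex (bernoulliWeight p) (ind C) +
            (if Aᶜ.card = 0 then ex (bernoulliWeight p) (ind C) else 0) := by
      intro A
      rw [sahiE_cons_rec_ite, sum_sub_update_mem]
    -- (5) the `ite` terms collapse to `A = univ`
    have hite : ∑ A : Finset (Fin (m + 1)),
        sahiE (bernoulliWeight p - bernoulliWeight (update p e 1)) A.card (fun j => ind (U' (A.orderEmbOfFin rfl j))) *
          (if Aᶜ.card = 0 then ex (bernoulliWeight p) (ind C) else 0) =
        sahiE (bernoulliWeight p - bernoulliWeight (update p e 1)) (m + 1) (fun j => ind (U' j)) * ex (bernoulliWeight p) (ind C) := by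
      have hcond : ∀ A : Finset (Fin (m + 1)), (Aᶜ.card = 0) = (A = univ) := fun A => by
        rw [Finset.card_eq_zero, Finset.compl_eq_empty_iff]
      simp only [hcond, mul_ite, mul_zero, Finset.sum_ite_eq', Finset.mem_univ, if_true]
      rw [sahiE_sub_univ (bernoulliWeight p - bernoulliWeight (update p e 1)) (fun j => ind (U' j))]
    -- (6) the double sum: pairs `(A, l ∈ Aᶜ)` ↔ `(l, B)`
    have hD : ∑ A : Finset (Fin (m + 1)),
        sahiE (bernoulliWeight p - bernoulliWeight (update p e 1)) A.card (fun j => ind (U' (A.orderEmbOfFin rfl j))) *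
          ∑ l ∈ Aᶜ, sahiE (bernoulliWeight p) Aᶜ.card
            (fun i => update (fun j => ind (secAt e true (U' j))) l
              ((fun j => ind (secAt e true (U' j))) l * ind C) (Aᶜ.orderEmbOfFin rfl i)) =
        ∑ l : Fin (m + 1), ∑ B : Finset (Fin m),
          sahiE (bernoulliWeight p - bernoulliWeight (update p e 1)) B.card
              (fun j => ind (U' (l.succAbove (B.orderEmbOfFin rfl j)))) *
            sahiE (bernoulliWeight p) (Bᶜ.card + 1)
              (Matrix.vecCons (ind (secAt e true (U' l) ∩ C))
                (fun j => ind (secAt e true (U' (l.succAbove (Bᶜ.orderEmbOfFin rfl j))))) : Fin (Bᶜ.card + 1) → Set ι → ℝ) := by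
      simp only [Finset.mul_sum]
      rw [sum_sum_compl_eq_sum_sum_map_succAbove]
      refine Finset.sum_congr rfl fun l _ => Finset.sum_congr rfl fun B _ => ?_
      congr 1
      · exact sahiE_sub_map_succAbove _ U' (fun X => ind X) l B
      · rw [sahiE_sub_congr _ _ (compl_map_succAbove l B),
          sahiE_sub_eq_cons_erase _ _ _ (Finset.mem_insert_self l _),
          sahiE_cons_sub_congr _ _ _ (Finset.erase_insert (fun h => by
            obtain ⟨y, -, hy⟩ := Finset.mem_map.mp h; exact Fin.succAbove_ne l y hy))]
        simp only [update_self, ind_mul_ind_eq_inter]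
        rw [show (fun j => update (fun j => ind (secAt e true (U' j))) l (ind (secAt e true (U' l) ∩ C))
              ((Bᶜ.map (Fin.succAboveEmb l)).orderEmbOfFin rfl j)) =
            fun j => ind (secAt e true (U' ((Bᶜ.map (Fin.succAboveEmb l)).orderEmbOfFin rfl j))) from
          sub_update_of_not_mem _ _ (fun h => by
            obtain ⟨y, -, hy⟩ := Finset.mem_map.mp h; exact Fin.succAbove_ne l y hy) _]
        exact sahiE_cons_sub_map_succAbove _ _ U' (fun X => ind (secAt e true X)) l Bᶜ
    -- (7) the right-hand sum, expanded
    have hRHS : ∑ A : Finset (Fin (m + 1)),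
        sahiE (bernoulliWeight p - bernoulliWeight (update p e 1)) A.card (fun j => ind (U' (A.orderEmbOfFin rfl j))) *
          sahiE (bernoulliWeight p) (Aᶜ.card + 1)
            (Matrix.vecCons (ind C) (fun j => ind (secAt e true (U' (Aᶜ.orderEmbOfFin rfl j)))) : Fin (Aᶜ.card + 1) → Set ι → ℝ) =
        (∑ l : Fin (m + 1), ∑ B : Finset (Fin m),
          sahiE (bernoulliWeight p - bernoulliWeight (update p e 1)) B.card
              (fun j => ind (U' (l.succAbove (B.orderEmbOfFin rfl j)))) *
            sahiE (bernoulliWeight p) (Bᶜ.card + 1)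
              (Matrix.vecCons (ind (secAt e true (U' l) ∩ C))
                (fun j => ind (secAt e true (U' (l.succAbove (Bᶜ.orderEmbOfFin rfl j))))) : Fin (Bᶜ.card + 1) → Set ι → ℝ)) -
        (∑ A : Finset (Fin (m + 1)),
          sahiE (bernoulliWeight p - bernoulliWeight (update p e 1)) A.card (fun j => ind (U' (A.orderEmbOfFin rfl j))) *
            sahiE (bernoulliWeight p) Aᶜ.card (fun j => ind (secAt e true (U' (Aᶜ.orderEmbOfFin rfl j))))) *
          ex (bernoulliWeight p) (ind C) +
        sahiE (bernoulliWeight p - bernoulliWeight (update p e 1)) (m + 1) (fun j => ind (U' j)) * ex (bernoulliWeight p) (ind C) := by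
      rw [← hD, ← hite, Finset.sum_mul, ← Finset.sum_sub_distrib, ← Finset.sum_add_distrib]
      refine Finset.sum_congr rfl fun A _ => ?_
      rw [hA A]
      ring
    -- (8) assemble
    rw [sahiE_cons, Xf, hR1, hRHS, hSE]
    simp only [hL]
    simp only [mul_sub, Finset.sum_sub_distrib, ← Finset.mul_sum]
    ring

end Main

end Pinning

end Summit.CriticalPhenomena.PercolationContinuityZ3.Theorems
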